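import Literature.Analysis.FluidPDE.TaoAveragedCascadeSteps
import Literature.Analysis.FluidPDE.TaoAveragedSlotSobolev
import Literature.Analysis.FluidPDE.TaoAveragedComplexAverageReal
import Mathlib.Analysis.InnerProductSpace.Calculus
import HarnessLib

/-!
# Tao 2016, §3.3: the scale-localising symbol `ρ` is a Fourier multiplier of order `0`

T. Tao, *Finite time blowup for an averaged three-dimensional Navier–Stokes equation*,
J. Amer. Math. Soc. **29** (2016), 601–674 = arXiv:1402.0290v3, §3.3, p. 16: "Let
`ρ(ξ₁) := Σ_{n ∈ ℤ} φ(ε₀⁻²((1+ε₀)^{-n}ξ₁ - ξ₁⁰))` … thus `ρ` is supported on the union of the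
balls `(1+ε₀)ⁿ · B(ξ₁⁰, 2ε₀²)` for `n ∈ ℤ`. Let `ρ(D)` be the associated Fourier multiplier; this
is easily checked to be a Fourier multiplier of order `0`."

For the tree's `rho` (`TaoAveragedCascadeReduction.lean`, the radial reading
`ρ(ξ) = Σₙ φ(|(1+ε₀)^{-n}ξ - ξ₁⁰|/ε₀²)`) this file proves that check and then **discharges the named fact
`betaRhoForm_isComplexAverage`** (`TaoAveragedCascadeSteps.lean`; the one-point datum with
`m₁ = ρ`, `m₂ = m₃ = 1`):

* `rhoBump` — the single bump `v ↦ φ(|v - ξ₁⁰|/ε₀²)`: smooth, supported in `B(ξ₁⁰, 2ε₀²)`, with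
  bounded iterated derivatives; `rho` is the sum of its dyadic rescalings;
* `rho_eventuallyEq_sum` — off the origin `ρ` is *locally a finite sum*: on the shell
  `{|ξ|/2 < |ξ'| < 2|ξ|}` only the indices `n` with `(1+ε₀)^{-n}|ξ| ∈ [1/4, 4]` contribute
  (`0 < ε₀ ≤ 1/2`), at most `N(ε₀)` of them;
* `rho_active_unique` — for `0 < ε₀ ≤ 1/5` at most one dyadic scale is active at each
  frequency (consecutive scales differ by `1+ε₀ > (1+2ε₀²)/(1-2ε₀²)`);
* `isComplexSymbol_rhoC` — **`ρ ∈ 𝓜₀ ⊗ ℂ`**: smooth off `0` and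
  `sup_{ξ ≠ 0} |ξ|ᵏ ‖∇ᵏρ(ξ)‖ ≤ 2ᵏ sup ‖∇ᵏ rhoBump‖ < ∞` (scale invariance of the seminorms
  (1.10): `‖∇ᵏ[g(λ·)](ξ)‖ ≤ λᵏ ‖(∇ᵏg)(λξ)‖`, and `λ|ξ| ≤ 2` on the active term);
* `rhoDatum`, `betaForm_rhoMultiplier` (`\widehat{ρ(D)u} = ρ û` inside the symbol form) and
  `betaRhoForm_isComplexAverage_holds` (threshold `ε₁ = 1/5`).

## References

* T. Tao, J. Amer. Math. Soc. 29 (2016), 601–674, arXiv:1402.0290v3, §3.3 p. 16, (1.10). Key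
  `Tao2016AveragedNS`.
-/

noncomputable section

open Set Filter
open scoped ENNReal NNReal Topology

namespace Literature.Analysis.FluidPDE.Tao2016

/-- Local notation for physical / frequency space `ℝ³`. -/
local notation "ℝ³" => EuclideanSpace ℝ (Fin 3)
/-- Local notation for the complexified range `ℂ³`. -/
local notation "ℂ³" => EuclideanSpace ℂ (Fin 3)

/-! ### The single bump `φ(|v - ξ₁⁰|/ε₀²)` -/

/-- The single frequency bump `v ↦ φ(|v - ξ₁⁰|/ε₀²)` whose dyadic rescalings sum to `ρ`. [cite: Tao2016AveragedNS, §3.3 p. 16] -/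
def rhoBump (ε₀ : ℝ) (v : ℝ³) : ℝ := freqCutoff (‖v - xi0 0‖ / ε₀ ^ 2)

/-- The `n`-th term of `ρ` is the bump at the rescaled frequency `(1+ε₀)^{-n} ξ`. [cite: Tao2016AveragedNS, §3.3 p. 16] -/
theorem rho_eq_tsum_rhoBump (ε₀ : ℝ) (ξ : ℝ³) :
    rho ε₀ ξ = ∑' n : ℤ, rhoBump ε₀ (((1 + ε₀) ^ (-n) : ℝ) • ξ) := rfl

/-- The bump vanishes off `B(ξ₁⁰, 2ε₀²)`. [cite: Tao2016AveragedNS, §3.3 p. 16] -/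
theorem rhoBump_eq_zero {ε₀ : ℝ} (hε : ε₀ ≠ 0) {v : ℝ³} (hv : 2 * ε₀ ^ 2 ≤ ‖v - xi0 0‖) :
    rhoBump ε₀ v = 0 := by
  have hε2 : 0 < ε₀ ^ 2 := by positivity
  refine freqCutoff_eq_zero ?_
  rw [abs_of_nonneg (by positivity), le_div_iff₀ hε2]
  exact hv

/-- The bump equals `1` on `B(ξ₁⁰, ε₀²)`. [cite: Tao2016AveragedNS, §3.3 p. 16] -/
theorem rhoBump_eq_one {ε₀ : ℝ} (hε : ε₀ ≠ 0) {v : ℝ³} (hv : ‖v - xi0 0‖ ≤ ε₀ ^ 2) :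
    rhoBump ε₀ v = 1 := by
  have hε2 : 0 < ε₀ ^ 2 := by positivity
  refine freqCutoff_eq_one ?_
  rw [abs_of_nonneg (by positivity), div_le_one hε2]
  exact hv

/-- If the bump does not vanish then `| |v| - 1 | < 2ε₀²`. [folklore] -/
theorem abs_norm_sub_one_lt_of_rhoBump_ne_zero {ε₀ : ℝ} (hε : ε₀ ≠ 0) {v : ℝ³}
    (hv : rhoBump ε₀ v ≠ 0) : |‖v‖ - 1| < 2 * ε₀ ^ 2 := by
  have h : ‖v - xi0 0‖ < 2 * ε₀ ^ 2 := by
    by_contra h'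
    exact hv (rhoBump_eq_zero hε (not_lt.1 h'))
  calc |‖v‖ - 1| = |‖v‖ - ‖xi0 0‖| := by rw [norm_xi0_zero]
    _ ≤ ‖v - xi0 0‖ := abs_norm_sub_norm_le _ _
    _ < 2 * ε₀ ^ 2 := h

/-- The bump is smooth (constant `1` near `ξ₁⁰`, a composition of smooth maps elsewhere). [folklore] -/
theorem contDiff_rhoBump {ε₀ : ℝ} (hε : ε₀ ≠ 0) {n : ℕ∞} : ContDiff ℝ n (rhoBump ε₀) := by
  rw [contDiff_iff_contDiffAt]
  intro v
  by_cases hv : v = xi0 0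
  · subst hv
    have hε2 : 0 < ε₀ ^ 2 := by positivity
    have h : rhoBump ε₀ =ᶠ[𝓝 (xi0 0)] fun _ => 1 := by
      filter_upwards [Metric.ball_mem_nhds (xi0 0) hε2] with w hw
      exact rhoBump_eq_one hε (le_of_lt (by simpa [dist_eq_norm] using hw))
    exact contDiffAt_const.congr_of_eventuallyEq h
  · have h1 : ContDiffAt ℝ n (fun w : ℝ³ => ‖w - xi0 0‖ / ε₀ ^ 2) v :=
      ((contDiffAt_id.sub contDiffAt_const).norm ℝ (sub_ne_zero.2 hv)).div_const _
    exact contDiff_freqCutoff.contDiffAt.comp v h1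

/-- The bump has compact support (`⊆ \overline{B}(ξ₁⁰, 2ε₀²)`). [folklore] -/
theorem hasCompactSupport_rhoBump {ε₀ : ℝ} (hε : ε₀ ≠ 0) : HasCompactSupport (rhoBump ε₀) := by
  refine HasCompactSupport.intro (isCompact_closedBall (xi0 0) (2 * ε₀ ^ 2)) fun v hv => ?_
  refine rhoBump_eq_zero hε (le_of_lt ?_)
  simpa [Metric.mem_closedBall, dist_eq_norm] using hv

/-- The iterated derivatives of the bump are bounded. [folklore] -/
theorem exists_bound_iteratedFDeriv_rhoBump {ε₀ : ℝ} (hε : ε₀ ≠ 0) (k : ℕ) :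
    ∃ M : ℝ, 0 ≤ M ∧ ∀ v : ℝ³, ‖iteratedFDeriv ℝ k (rhoBump ε₀) v‖ ≤ M := by
  obtain ⟨M, hM⟩ := ((hasCompactSupport_rhoBump hε).iteratedFDeriv k).exists_bound_of_continuous
    ((contDiff_rhoBump hε (n := ⊤)).continuous_iteratedFDeriv (by exact_mod_cast le_top))
  exact ⟨max M 0, le_max_right _ _, fun v => (hM v).trans (le_max_left _ _)⟩

/-! ### Local finiteness of `ρ` off the origin -/

/-- The contributing indices at `ξ`: `n` with `(1+ε₀)^{-n}|ξ| ∈ [1/4, 4]`. [folklore] -/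
def rhoIndexSet (ε₀ : ℝ) (ξ : ℝ³) : Set ℤ :=
  {n : ℤ | (1 / 4 : ℝ) ≤ (1 + ε₀) ^ (-n) * ‖ξ‖ ∧ (1 + ε₀) ^ (-n) * ‖ξ‖ ≤ 4}

/-- The contributing indices form a finite set (`ξ ≠ 0`, `ε₀ > 0`). [folklore] -/
theorem rhoIndexSet_finite {ε₀ : ℝ} (hε : 0 < ε₀) {ξ : ℝ³} (hξ : ξ ≠ 0) :
    (rhoIndexSet ε₀ ξ).Finite := by
  have h1 : 1 < 1 + ε₀ := by linarith
  have ha : 0 < 1 + ε₀ := by linarith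
  have hlog : 0 < Real.log (1 + ε₀) := Real.log_pos h1
  have hnorm : 0 < ‖ξ‖ := norm_pos_iff.2 hξ
  refine (Set.finite_Icc ⌊Real.log (‖ξ‖ / 4) / Real.log (1 + ε₀)⌋
    ⌈Real.log (4 * ‖ξ‖) / Real.log (1 + ε₀)⌉).subset fun n hn => ?_
  obtain ⟨hlo, hhi⟩ := hn
  have hpos : 0 < (1 + ε₀) ^ n := zpow_pos ha n
  rw [zpow_neg] at hlo hhi
  -- `‖ξ‖/4 ≤ (1+ε₀)^n ≤ 4‖ξ‖`
  have hA : ‖ξ‖ / 4 ≤ (1 + ε₀) ^ n := by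
    rw [div_le_iff₀ (by norm_num : (0 : ℝ) < 4)]
    have := mul_le_mul_of_nonneg_left hhi hpos.le
    rw [← mul_assoc, mul_inv_cancel₀ hpos.ne', one_mul] at this
    linarith
  have hB : (1 + ε₀) ^ n ≤ 4 * ‖ξ‖ := by
    have := mul_le_mul_of_nonneg_left hlo hpos.le
    rw [← mul_assoc, mul_inv_cancel₀ hpos.ne', one_mul] at this
    linarith
  have hlogn : Real.log ((1 + ε₀) ^ n) = n * Real.log (1 + ε₀) := Real.log_zpow _ _
  constructor
  · have h := Real.log_le_log (by positivity) hA
    rw [hlogn] at h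
    have h' : Real.log (‖ξ‖ / 4) / Real.log (1 + ε₀) ≤ n := by
      rw [div_le_iff₀ hlog]
      exact h
    exact_mod_cast (Int.floor_le _).trans h'
  · have h := Real.log_le_log hpos hB
    rw [hlogn] at h
    have h' : (n : ℝ) ≤ Real.log (4 * ‖ξ‖) / Real.log (1 + ε₀) := by
      rw [le_div_iff₀ hlog]
      exact h
    exact_mod_cast h'.trans (Int.le_ceil _)

/-- The `n`-th term of `ρ` as a function of `ξ`. [cite: Tao2016AveragedNS, §3.3 p. 16] -/
def rhoTerm (ε₀ : ℝ) (n : ℤ) (ξ : ℝ³) : ℝ := rhoBump ε₀ (((1 + ε₀) ^ (-n) : ℝ) • ξ)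

/-- `ρ = Σₙ rhoTerm n`. [cite: Tao2016AveragedNS, §3.3 p. 16] -/
theorem rho_eq_tsum_rhoTerm (ε₀ : ℝ) (ξ : ℝ³) : rho ε₀ ξ = ∑' n : ℤ, rhoTerm ε₀ n ξ := rfl

/-- A non-vanishing term pins the rescaled modulus: `|(1+ε₀)^{-n}|ξ| - 1| < 2ε₀²`. [folklore] -/
theorem abs_sub_one_lt_of_rhoTerm_ne_zero {ε₀ : ℝ} (hε : 0 < ε₀) {n : ℤ} {ξ : ℝ³}
    (h : rhoTerm ε₀ n ξ ≠ 0) : |(1 + ε₀) ^ (-n) * ‖ξ‖ - 1| < 2 * ε₀ ^ 2 := by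
  have h' := abs_norm_sub_one_lt_of_rhoBump_ne_zero hε.ne' h
  rwa [norm_smul, Real.norm_eq_abs, abs_of_pos (zpow_pos (show (0 : ℝ) < 1 + ε₀ by linarith) _)] at h'

/-- Off the finite index set the terms vanish on the shell `{|ξ|/2 < |ξ'| < 2|ξ|}`
(`0 < ε₀ ≤ 1/2`). [folklore] -/
theorem rhoTerm_eq_zero_of_not_mem {ε₀ : ℝ} (hε : 0 < ε₀) (hε' : ε₀ ≤ 1 / 2) {ξ ξ' : ℝ³}
    (h₁ : ‖ξ‖ / 2 < ‖ξ'‖) (h₂ : ‖ξ'‖ < 2 * ‖ξ‖) {n : ℤ} (hn : n ∉ rhoIndexSet ε₀ ξ) :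
    rhoTerm ε₀ n ξ' = 0 := by
  by_contra hne
  have h := abs_sub_one_lt_of_rhoTerm_ne_zero hε hne
  have hε2 : 2 * ε₀ ^ 2 ≤ 1 / 2 := by nlinarith
  rw [abs_lt] at h
  have hl : 0 < (1 + ε₀) ^ (-n) := zpow_pos (by linarith) _
  apply hn
  constructor
  · -- `(1+ε₀)^{-n} ‖ξ‖ ≥ (1+ε₀)^{-n} ‖ξ'‖ / 2 > 1/4`
    nlinarith [mul_le_mul_of_nonneg_left h₂.le hl.le]
  · nlinarith [mul_le_mul_of_nonneg_left h₁.le hl.le]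

/-- **`ρ` is locally a finite sum off the origin**: on the shell `{|ξ|/2 < |ξ'| < 2|ξ|}` around
`ξ ≠ 0`, `ρ = Σ_{n ∈ S(ξ)} rhoTerm n` with the finite set `S(ξ) = rhoIndexSet ε₀ ξ`. [folklore] -/
theorem rho_eventuallyEq_sum {ε₀ : ℝ} (hε : 0 < ε₀) (hε' : ε₀ ≤ 1 / 2) {ξ : ℝ³} (hξ : ξ ≠ 0) :
    rho ε₀ =ᶠ[𝓝 ξ] fun ξ' => ∑ n ∈ (rhoIndexSet_finite hε hξ).toFinset, rhoTerm ε₀ n ξ' := by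
  have hnorm : 0 < ‖ξ‖ := norm_pos_iff.2 hξ
  have hU : {ξ' : ℝ³ | ‖ξ‖ / 2 < ‖ξ'‖ ∧ ‖ξ'‖ < 2 * ‖ξ‖} ∈ 𝓝 ξ := by
    refine (IsOpen.and (isOpen_lt continuous_const continuous_norm)
      (isOpen_lt continuous_norm continuous_const)).mem_nhds ⟨by linarith, by linarith⟩
  filter_upwards [hU] with ξ' hξ'
  rw [rho_eq_tsum_rhoTerm]
  refine tsum_eq_sum fun n hn => ?_
  rw [Set.Finite.mem_toFinset] at hn
  exact rhoTerm_eq_zero_of_not_mem hε hε' hξ'.1 hξ'.2 hn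

/-- Each term is smooth. [folklore] -/
theorem contDiff_rhoTerm {ε₀ : ℝ} (hε : ε₀ ≠ 0) (n : ℤ) {m : ℕ∞} : ContDiff ℝ m (rhoTerm ε₀ n) :=
  (contDiff_rhoBump hε).comp (contDiff_const_smul _)

/-- **`ρ` is smooth off the origin.** [cite: Tao2016AveragedNS, §3.3 p. 16] -/
theorem contDiffOn_rho {ε₀ : ℝ} (hε : 0 < ε₀) (hε' : ε₀ ≤ 1 / 2) :
    ContDiffOn ℝ ((⊤ : ℕ∞) : WithTop ℕ∞) (rho ε₀) {0}ᶜ := by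
  intro ξ hξ
  have h := rho_eventuallyEq_sum hε hε' (ξ := ξ) hξ
  refine (ContDiffAt.congr_of_eventuallyEq ?_ h).contDiffWithinAt
  exact ContDiffAt.sum fun n _ => (contDiff_rhoTerm hε.ne' n).contDiffAt

/-! ### Iterated derivatives of `ρ` -/

/-- The iterated derivative of `ρ` at `ξ ≠ 0` is the finite sum of those of the terms. [folklore] -/
theorem iteratedFDeriv_rho {ε₀ : ℝ} (hε : 0 < ε₀) (hε' : ε₀ ≤ 1 / 2) {ξ : ℝ³} (hξ : ξ ≠ 0) (k : ℕ) :
    iteratedFDeriv ℝ k (rho ε₀) ξ =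
      ∑ n ∈ (rhoIndexSet_finite hε hξ).toFinset, iteratedFDeriv ℝ k (rhoTerm ε₀ n) ξ := by
  rw [((rho_eventuallyEq_sum hε hε' hξ).iteratedFDeriv (𝕜 := ℝ) k).eq_of_nhds]
  exact iteratedFDeriv_fun_sum_apply fun n _ => (contDiff_rhoTerm hε.ne' n).contDiffAt

/-- Scale invariance of the seminorms: `‖∇ᵏ[g(λ·)](ξ)‖ ≤ λᵏ ‖(∇ᵏg)(λξ)‖` (`λ > 0`). [cite: Tao2016AveragedNS, (1.10)] -/
theorem norm_iteratedFDeriv_rhoTerm_le {ε₀ : ℝ} (hε : 0 < ε₀) (n : ℤ) (ξ : ℝ³) (k : ℕ) :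
    ‖iteratedFDeriv ℝ k (rhoTerm ε₀ n) ξ‖ ≤
      ((1 + ε₀) ^ (-n)) ^ k * ‖iteratedFDeriv ℝ k (rhoBump ε₀) (((1 + ε₀) ^ (-n) : ℝ) • ξ)‖ := by
  have hl : 0 < (1 + ε₀) ^ (-n) := zpow_pos (by linarith) _
  have hcomp : rhoTerm ε₀ n = rhoBump ε₀ ∘ (((1 + ε₀) ^ (-n) : ℝ) • ContinuousLinearMap.id ℝ ℝ³) := by
    funext ξ
    rfl
  rw [hcomp, ContinuousLinearMap.iteratedFDeriv_comp_right _ (contDiff_rhoBump hε.ne') ξ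
    (by exact_mod_cast le_top)]
  refine (ContinuousMultilinearMap.norm_compContinuousLinearMap_le _ _).trans ?_
  rw [Finset.prod_const, Finset.card_univ, Fintype.card_fin, mul_comm]
  gcongr
  · rw [norm_smul, Real.norm_eq_abs, abs_of_pos hl]
    exact mul_le_of_le_one_right hl.le ContinuousLinearMap.norm_id_le
  · rfl

/-- The iterated derivatives of the bump vanish off `\overline{B}(ξ₁⁰, 2ε₀²)`. [folklore] -/
theorem iteratedFDeriv_rhoBump_eq_zero {ε₀ : ℝ} (hε : ε₀ ≠ 0) {v : ℝ³} (hv : 2 * ε₀ ^ 2 < ‖v - xi0 0‖)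
    (k : ℕ) : iteratedFDeriv ℝ k (rhoBump ε₀) v = 0 := by
  have hnot : v ∉ tsupport (rhoBump ε₀) := by
    intro hmem
    have hsub : tsupport (rhoBump ε₀) ⊆ {w : ℝ³ | ‖w - xi0 0‖ ≤ 2 * ε₀ ^ 2} :=
      closure_minimal (fun w hw => by
        by_contra h'
        exact hw (rhoBump_eq_zero hε (not_le.1 h').le)) (isClosed_le (continuous_norm.comp
          (continuous_id.sub continuous_const)) continuous_const)
    exact (not_le.2 hv) (hsub hmem)
  exact image_eq_zero_of_notMem_tsupport fun hmem => hnot (tsupport_iteratedFDeriv_subset k hmem)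

/-! ### At most one active scale, and the seminorm bound -/

/-- **At most one dyadic scale is active at each frequency** (`0 < ε₀ ≤ 1/5`): if
`|(1+ε₀)^{-n}|ξ| - 1| ≤ 2ε₀²` and `|(1+ε₀)^{-n'}|ξ| - 1| ≤ 2ε₀²` then `n = n'`, because consecutive
scales differ by the factor `1+ε₀ > (1+2ε₀²)/(1-2ε₀²)`. [cite: Tao2016AveragedNS, §3.3 p. 16] -/
theorem rho_active_unique {ε₀ : ℝ} (hε : 0 < ε₀) (hε' : ε₀ ≤ 1 / 5) {ξ : ℝ³} {n n' : ℤ}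
    (hn : |(1 + ε₀) ^ (-n) * ‖ξ‖ - 1| ≤ 2 * ε₀ ^ 2)
    (hn' : |(1 + ε₀) ^ (-n') * ‖ξ‖ - 1| ≤ 2 * ε₀ ^ 2) : n = n' := by
  have ha : 1 ≤ 1 + ε₀ := by linarith
  have ha0 : 0 < 1 + ε₀ := by linarith
  rw [abs_le] at hn hn'
  -- the key numerical fact
  have key : ∀ {m m' : ℤ}, m < m' →
      -(2 * ε₀ ^ 2) ≤ (1 + ε₀) ^ (-m') * ‖ξ‖ - 1 → (1 + ε₀) ^ (-m) * ‖ξ‖ - 1 ≤ 2 * ε₀ ^ 2 →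
        False := by
    intro m m' hlt hlo hhi
    have hstep : (1 + ε₀) * (1 + ε₀) ^ (-m') ≤ (1 + ε₀) ^ (-m) := by
      rw [← zpow_one_add₀ ha0.ne']
      exact zpow_le_zpow_right₀ ha (by omega)
    have hpos : 0 ≤ (1 + ε₀) ^ (-m') * ‖ξ‖ := mul_nonneg (zpow_pos ha0 _).le (norm_nonneg _)
    have h1 : (1 + ε₀) * ((1 + ε₀) ^ (-m') * ‖ξ‖) ≤ (1 + ε₀) ^ (-m) * ‖ξ‖ := by
      rw [← mul_assoc]
      exact mul_le_mul_of_nonneg_right hstep (norm_nonneg _)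
    nlinarith
  rcases lt_trichotomy n n' with h | h | h
  · exact (key h hn'.1 hn.2).elim
  · exact h
  · exact (key h hn.1 hn'.2).elim

/-- **The seminorm bound**: `|ξ|ᵏ ‖∇ᵏρ(ξ)‖ ≤ 2ᵏ M_k` for `ξ ≠ 0`, with `M_k` a bound for
`‖∇ᵏ rhoBump‖` (`0 < ε₀ ≤ 1/5`). [cite: Tao2016AveragedNS, §3.3 p. 16 and (1.10)] -/
theorem norm_pow_mul_norm_iteratedFDeriv_rho_le {ε₀ : ℝ} (hε : 0 < ε₀) (hε' : ε₀ ≤ 1 / 5)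
    {ξ : ℝ³} (hξ : ξ ≠ 0) (k : ℕ) {M : ℝ} (hM0 : 0 ≤ M)
    (hM : ∀ v : ℝ³, ‖iteratedFDeriv ℝ k (rhoBump ε₀) v‖ ≤ M) :
    ‖ξ‖ ^ k * ‖iteratedFDeriv ℝ k (rho ε₀) ξ‖ ≤ 2 ^ k * M := by
  have hε2 : ε₀ ≤ 1 / 2 := by linarith
  have ha0 : 0 < 1 + ε₀ := by linarith
  set S := (rhoIndexSet_finite hε hξ).toFinset with hS
  -- the active indices
  set P : ℤ → Prop := fun n => |(1 + ε₀) ^ (-n) * ‖ξ‖ - 1| ≤ 2 * ε₀ ^ 2 with hP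
  -- termwise bound by an indicator
  have hterm : ∀ n, ‖iteratedFDeriv ℝ k (rhoTerm ε₀ n) ξ‖ ≤
      if P n then ((1 + ε₀) ^ (-n)) ^ k * M else 0 := by
    intro n
    by_cases hPn : P n
    · rw [if_pos hPn]
      exact (norm_iteratedFDeriv_rhoTerm_le hε n ξ k).trans
        (mul_le_mul_of_nonneg_left (hM _) (pow_nonneg (zpow_pos ha0 _).le _))
    · rw [if_neg hPn]
      refine (norm_iteratedFDeriv_rhoTerm_le hε n ξ k).trans (le_of_eq ?_)
      rw [iteratedFDeriv_rhoBump_eq_zero hε.ne' ?_ k, norm_zero, mul_zero]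
      -- inactive: `‖λξ - ξ⁰‖ > 2ε₀²`
      by_contra hle
      apply hPn
      have hle' : ‖((1 + ε₀) ^ (-n) : ℝ) • ξ - xi0 0‖ ≤ 2 * ε₀ ^ 2 := not_lt.1 hle
      calc |(1 + ε₀) ^ (-n) * ‖ξ‖ - 1| = |‖((1 + ε₀) ^ (-n) : ℝ) • ξ‖ - ‖xi0 0‖| := by
            rw [norm_smul, Real.norm_eq_abs, abs_of_pos (zpow_pos ha0 _), norm_xi0_zero]
        _ ≤ ‖((1 + ε₀) ^ (-n) : ℝ) • ξ - xi0 0‖ := abs_norm_sub_norm_le _ _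
        _ ≤ 2 * ε₀ ^ 2 := hle'
  -- at most one active index in `S`
  have hcard : (S.filter P).card ≤ 1 :=
    Finset.card_le_one.2 fun a ha b hb =>
      rho_active_unique hε hε' (Finset.mem_filter.1 ha).2 (Finset.mem_filter.1 hb).2
  -- active indices have `λ ‖ξ‖ ≤ 2`
  have hact : ∀ n, P n → ‖ξ‖ * (1 + ε₀) ^ (-n) ≤ 2 := by
    intro n hPn
    have h := (abs_le.1 hPn).2
    nlinarith [sq_nonneg ε₀]
  calc ‖ξ‖ ^ k * ‖iteratedFDeriv ℝ k (rho ε₀) ξ‖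
      = ‖ξ‖ ^ k * ‖∑ n ∈ S, iteratedFDeriv ℝ k (rhoTerm ε₀ n) ξ‖ := by
        rw [iteratedFDeriv_rho hε hε2 hξ k]
    _ ≤ ‖ξ‖ ^ k * ∑ n ∈ S, (if P n then ((1 + ε₀) ^ (-n)) ^ k * M else 0) := by
        gcongr
        exact (norm_sum_le _ _).trans (Finset.sum_le_sum fun n _ => hterm n)
    _ = ∑ n ∈ S.filter P, ‖ξ‖ ^ k * (((1 + ε₀) ^ (-n)) ^ k * M) := by
        rw [Finset.sum_filter, Finset.mul_sum]
        refine Finset.sum_congr rfl fun n _ => ?_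
        split_ifs <;> simp
    _ ≤ ∑ n ∈ S.filter P, 2 ^ k * M := by
        refine Finset.sum_le_sum fun n hn => ?_
        have hPn := (Finset.mem_filter.1 hn).2
        rw [← mul_assoc, ← mul_pow]
        exact mul_le_mul_of_nonneg_right (pow_le_pow_left₀ (by positivity) (hact n hPn) k) hM0
    _ = (S.filter P).card * (2 ^ k * M) := by rw [Finset.sum_const, nsmul_eq_mul]
    _ ≤ 1 * (2 ^ k * M) := by
        gcongr
        exact_mod_cast hcard
    _ = 2 ^ k * M := one_mul _

/-! ### `ρ ∈ 𝓜₀ ⊗ ℂ` -/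

/-- The complexified symbol `ξ ↦ (ρ(ξ) : ℂ)`. [cite: Tao2016AveragedNS, §3.3 p. 16] -/
def rhoC (ε₀ : ℝ) (ξ : ℝ³) : ℂ := (rho ε₀ ξ : ℂ)

/-- Norms of iterated derivatives of the complexified symbol off the origin. [folklore] -/
theorem norm_iteratedFDeriv_rhoC {ε₀ : ℝ} (hε : 0 < ε₀) (hε' : ε₀ ≤ 1 / 2) {ξ : ℝ³} (hξ : ξ ≠ 0)
    (k : ℕ) : ‖iteratedFDeriv ℝ k (rhoC ε₀) ξ‖ = ‖iteratedFDeriv ℝ k (rho ε₀) ξ‖ := by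
  have hopen : IsOpen ({0}ᶜ : Set ℝ³) := isOpen_compl_singleton
  have hmem : ξ ∈ ({0}ᶜ : Set ℝ³) := hξ
  rw [← iteratedFDerivWithin_of_isOpen k hopen hmem, ← iteratedFDerivWithin_of_isOpen k hopen hmem]
  have hcd : ContDiffWithinAt ℝ k (rho ε₀) ({0}ᶜ : Set ℝ³) ξ :=
    ((contDiffOn_rho hε hε').of_le (by exact_mod_cast le_top)) ξ hmem
  exact Complex.ofRealLI.norm_iteratedFDerivWithin_comp_left (f := rho ε₀) hcd hopen.uniqueDiffOn
    hmem (i := k) le_rfl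

/-- **`ρ(D)` is a (complex) Fourier multiplier of order `0`** ("easily checked", Tao p. 16):
`ρ` is smooth off the origin and all seminorms (1.10) are finite, for `0 < ε₀ ≤ 1/5`. [cite: Tao2016AveragedNS, §3.3 p. 16] -/
theorem isComplexSymbol_rhoC {ε₀ : ℝ} (hε : 0 < ε₀) (hε' : ε₀ ≤ 1 / 5) : IsComplexSymbol (rhoC ε₀) := by
  have hε2 : ε₀ ≤ 1 / 2 := by linarith
  refine ⟨Complex.ofRealCLM.contDiff.comp_contDiffOn (contDiffOn_rho hε hε2), fun k => ?_⟩
  obtain ⟨M, hM0, hM⟩ := exists_bound_iteratedFDeriv_rhoBump hε.ne' k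
  refine lt_of_le_of_lt (iSup₂_le fun ξ hξ => ?_) (ENNReal.ofReal_lt_top (r := 2 ^ k * M))
  have hξ' : ξ ≠ 0 := hξ
  have h := norm_pow_mul_norm_iteratedFDeriv_rho_le hε hε' hξ' k hM0 hM
  rw [← norm_iteratedFDeriv_rhoC hε hε2 hξ' k] at h
  calc (‖ξ‖₊ : ℝ≥0∞) ^ k * ‖iteratedFDeriv ℝ k (rhoC ε₀) ξ‖₊
      = ENNReal.ofReal (‖ξ‖ ^ k * ‖iteratedFDeriv ℝ k (rhoC ε₀) ξ‖) := by
        rw [ENNReal.ofReal_mul (by positivity), ENNReal.ofReal_pow (norm_nonneg _), ofReal_norm,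
          ofReal_norm, enorm_eq_nnnorm, enorm_eq_nnnorm]
    _ ≤ ENNReal.ofReal (2 ^ k * M) := ENNReal.ofReal_le_ofReal h

/-! ### The one-point datum `m₁ = ρ`: discharge of `betaRhoForm_isComplexAverage` -/

open MeasureTheory

/-- **The one-point complex datum of §3.3**: `Ω` a point, `m₁ = ρ`, `m₂ = m₃ = 1`, no rotation,
no dilation ("By Definition 3.4, the bilinear operator `B_{η,ρ}` defined by
`B_{η,ρ}(u,v) := B_η(ρ(D)u, v)` is clearly a complex average of `B_η`"). [cite: Tao2016AveragedNS, §3.3 p. 16] -/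
def rhoDatum {ε₀ : ℝ} (hε : 0 < ε₀) (hε' : ε₀ ≤ 1 / 5) : ComplexAveragingDatum where
  Ω := Unit
  μ := Measure.dirac ()
  m i _ := if i = 0 then rhoC ε₀ else fun _ => 1
  R _ _ := LinearIsometryEquiv.refl ℝ _
  lam _ _ := 1
  isComplexSymbol i _ := by
    by_cases hi : i = 0
    · simp only [hi, if_true]
      exact isComplexSymbol_rhoC hε hε'
    · simp only [hi, if_false]
      exact isComplexSymbol_const 1
  det_R _ _ := LinearMap.det_id
  lam_pos _ _ := one_pos
  lam_bdd := ⟨1, fun _ _ => by norm_num⟩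
  moment k₁ k₂ k₃ := by
    rw [lintegral_dirac]
    simp only [if_true, show (1 : Fin 3) ≠ 0 by decide, show (2 : Fin 3) ≠ 0 by decide, if_false]
    exact ENNReal.mul_lt_top (ENNReal.mul_lt_top ((isComplexSymbol_rhoC hε hε').2 k₁)
      ((isComplexSymbol_const 1).2 k₂)) ((isComplexSymbol_const 1).2 k₃)
  measurable_m _ _ _ := measurable_const
  measurable_R _ _ := measurable_const
  measurable_lam _ := measurable_const

/-- Slot `0` of the one-point datum is `ρ(D)`. [cite: Tao2016AveragedNS, §3.3 p. 16] -/
theorem rhoDatum_slot_zero {ε₀ : ℝ} (hε : 0 < ε₀) (hε' : ε₀ ≤ 1 / 5) (θ : Unit) (u : L2C) :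
    (rhoDatum hε hε').slot 0 θ u =
      fourierMultiplier ((isComplexSymbol_rhoC hε hε').memLp_top.toLp (rhoC ε₀)) u := by
  unfold ComplexAveragingDatum.slot ComplexAveragingDatum.symbolLp
  rw [show (rhoDatum hε hε').lam 0 θ = 1 from rfl, dil_one,
    show (rhoDatum hε hε').R 0 θ = LinearIsometryEquiv.refl ℝ _ from rfl, rot_refl]
  rfl

/-- Slots `1, 2` of the one-point datum are the identity. [folklore] -/
theorem rhoDatum_slot_of_ne_zero {ε₀ : ℝ} (hε : 0 < ε₀) (hε' : ε₀ ≤ 1 / 5) {i : Fin 3} (hi : i ≠ 0)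
    (θ : Unit) (u : L2C) : (rhoDatum hε hε').slot i θ u = u := by
  unfold ComplexAveragingDatum.slot
  rw [show (rhoDatum hε hε').lam i θ = 1 from rfl, dil_one,
    show (rhoDatum hε hε').R i θ = LinearIsometryEquiv.refl ℝ _ from rfl, rot_refl]
  have h : (rhoDatum hε hε').symbolLp i θ =
      (memLp_top_const (μ := (volume : Measure ℝ³)) (1 : ℂ)).toLp _ := by
    unfold ComplexAveragingDatum.symbolLp
    exact MemLp.toLp_congr _ _ (Eventually.of_forall fun ξ => by
      show (if i = 0 then rhoC ε₀ else fun _ => (1 : ℂ)) ξ = 1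
      rw [if_neg hi])
  rw [h, fourierMultiplier_one]

/-- **`⟨B_{η,ρ}(u,v), w⟩ = ⟨B_η(ρ(D)u, v), w⟩`** for the symbol forms: `\widehat{ρ(D)u} = ρ û`. [cite: Tao2016AveragedNS, §3.3 p. 16] -/
theorem betaForm_rhoMultiplier {ε₀ : ℝ} (hε : 0 < ε₀) (hε' : ε₀ ≤ 1 / 5) (u v w : L2C) :
    betaForm ε₀ (fourierMultiplier ((isComplexSymbol_rhoC hε hε').memLp_top.toLp (rhoC ε₀)) u) v w =
      betaRhoForm ε₀ u v w := by
  unfold betaForm betaRhoForm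
  congr 1
  refine integral_congr_ae ?_
  filter_upwards [Measure.quasiMeasurePreserving_fst.ae_eq
    (fourierFn_fourierMultiplier_toLp (isComplexSymbol_rhoC hε hε').memLp_top u)] with p hp
  have hp' : fourierFn (fourierMultiplier ((isComplexSymbol_rhoC hε hε').memLp_top.toLp (rhoC ε₀)) u)
      p.1 = rhoC ε₀ p.1 • fourierFn u p.1 := hp
  rw [hp', Λ_smul₁, rhoC]
  push_cast
  ring

/-- The average over the one-point datum is evaluation at the point. [folklore] -/
theorem rhoDatum_average {ε₀ : ℝ} (hε : 0 < ε₀) (hε' : ε₀ ≤ 1 / 5) (C' : L2C → L2C → L2C → ℂ)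
    (u v w : L2C) :
    (rhoDatum hε hε').average C' u v w =
      C' ((rhoDatum hε hε').slot 0 () u) ((rhoDatum hε hε').slot 1 () v)
        ((rhoDatum hε hε').slot 2 () w) :=
  integral_dirac _ ()

/-- **Discharge of `betaRhoForm_isComplexAverage` (Tao 2016, §3.3, last paragraph)**: for
`0 < ε₀ ≤ 1/5`, `B_{η,ρ}` is a complex average of `B_η` — the one-point datum with `m₁ = ρ`
(an order-`0` multiplier, `isComplexSymbol_rhoC`), `m₂ = m₃ = 1`. [cite: Tao2016AveragedNS, §3.3 p. 16] -/
theorem betaRhoForm_isComplexAverage_holds : betaRhoForm_isComplexAverage := by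
  refine ⟨1 / 5, by norm_num, fun ε₀ hε hε' => ⟨rhoDatum hε hε', fun u v w _ _ _ => ?_⟩⟩
  rw [rhoDatum_average, rhoDatum_slot_zero,
    rhoDatum_slot_of_ne_zero hε hε' (show (1 : Fin 3) ≠ 0 by decide),
    rhoDatum_slot_of_ne_zero hε hε' (show (2 : Fin 3) ≠ 0 by decide), betaForm_rhoMultiplier]
  · exact hε
  · exact hε'

end Literature.Analysis.FluidPDE.Tao2016
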